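import Summits.QuantumFields.YangMills.Theorems.UnitScaleTiltProp7AliasSumBernsteinUp
import Summits.QuantumFields.YangMills.Theorems.UnitScaleTiltProp7FlatRRowConst
import HarnessLib

/-!
# Route `UnitScaleTilt`, crux K1 «MinimiserStabilityRegPr» (stmt-QuantumFields-19200), route-R E′ S3 ∕ line «HKGK-ANALYTIC», row J-ROW★ (★ym-ust-19200-w4 g7,
# 2026-08-29 00:26Z) — THE FLAT CORE ONE BERNSTEIN ORDER UP, IN `Site (F.P K) 0` LETTERS: for the curl-minimal interpolant `A` of a coarse weight `ν`
# (`Δ A_κ = ((Q_k)ᵀν)_κ`, `A_κ ⊥ 1`, `ν` mean-free per direction), `(L^k)²·Σ_b ((ΔA)(b))² ≤ C_J·Σ_b Σ_ν (A(b + e_ν) − A(b))²`, `C_J = dπ²·(1 + (π²∕4)^{d+1})` ABSOLUTE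

DRAFT (px6 g4).  THEOREMS ONLY (0 `def`, 0 `sorry`); `--supports stmt-QuantumFields-19200 --as helper`, count-neutral.
-/

set_option autoImplicit false

noncomputable section

open scoped BigOperators Matrix ComplexConjugate
open Finset

namespace Summit.QuantumFields.YangMills.Theorems.Prop7FlatJRowConst

open Literature.MathematicalPhysics.QuantumFieldTheory.Balaban1983to89
open B4Strip B5Prop11Fiber B5Prop11Leaves B5Prop11Plancherel B5Action121 B5Block118 B5LaplaceInverse B5LaplaceSpectral
open B5Momentum130 B5Momentum133 B5Eq135Momentum
open Summit.QuantumFields.YangMills.Theorems.Prop7AliasSumBernsteinUp (bernstein_up_QvOp_adjoint_pos)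

/-! ## §1 Read on the interpolant (B5 carrier) -/

section Interpolant

variable {d : ℕ} (n : ℕ) [NeZero n] (M : Fin d → ℕ) [hM : ∀ μ, NeZero (M μ)]

open Summit.QuantumFields.YangMills.Theorems.Prop7FlatRRowConstTorus (star_dotProduct_LapS_mulVec sum_norm_sdiff_sq re_star_dotProduct_comm)
open Summit.QuantumFields.YangMills.Theorems.Prop7CentreHarmonicDivDictionary (LapS_natCast_mulVec)

/-- ★★ **BERNSTEIN ONE ORDER UP FOR THE CURL-MINIMAL INTERPOLANT** (`C_J = dπ²·(1 + (π²∕4)^{d+1})`, absolute): on the fine torus `Tor (fine n M)` (`n ≥ 1`), if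
`Δ_n u = c·((Q_n)ᴴB)_κ` (any scale `c : ℂ`), `Σ_x u(x) = 0`, and `B` is MEAN-FREE in direction `κ`, then
`n²·Σ_x |(Δ_1u)(x)|² ≤ C_J·Σ_ν Σ_x |u(x+e_ν) − u(x)|²` (`Δ_1 = LapS … 1` the lattice-unit Laplacian) — the interpolant's LAPLACIAN is `ℓ⁻¹`-dominated by its gradient,
uniformly in `n`, `M`, `c` (✓`Prop7AliasSumBernsteinUp.bernstein_up_QvOp_adjoint_pos` read on `u = c·Δ_n⁻¹g`; twin of ✓`Prop7FlatRRowConstTorus.bernstein_interpolant` one order up).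
[cite: Balaban1984PropagatorsI, (1.18) p.20, (1.21) p.21, Sect. C p.22; Balaban1985Variational, Prop. 7 p.299] -/
theorem bernstein_interpolant_up (hn : 1 ≤ n) (B : Tor M × Fin d → ℂ) (κ : Fin d) (hB : ∑ y, B (y, κ) = 0)
    (c : ℂ) (u : Tor (fine n M) → ℂ) (hu : ∑ x, u x = 0)
    (hLap : LapS (fine n M) (n : ℂ) *ᵥ u = c • comp (fine n M) ((QvOp n M)ᴴ *ᵥ B) κ) :
    (n : ℝ) ^ 2 * ∑ x, ‖(LapS (fine n M) 1 *ᵥ u) x‖ ^ 2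
      ≤ (d * Real.pi ^ 2 * (1 + (Real.pi ^ 2 / 4) ^ (d + 1))) * ∑ ν : Fin d, ∑ x, ‖u (x + unitVec (fine n M) ν) - u x‖ ^ 2 := by
  set g : Tor (fine n M) → ℂ := comp (fine n M) ((QvOp n M)ᴴ *ᵥ B) κ with hg
  set v : Tor (fine n M) → ℂ := LapSinv (fine n M) (n : ℂ) *ᵥ g with hv
  set CJ : ℝ := d * Real.pi ^ 2 * (1 + (Real.pi ^ 2 / 4) ^ (d + 1)) with hCJ
  have hn0 : ((n : ℕ) : ℂ) ≠ 0 := by exact_mod_cast (Nat.one_le_iff_ne_zero.mp hn)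
  have hnR : (0 : ℝ) < n := by exact_mod_cast hn
  -- `u = c • Δ_n⁻¹ g`
  have huv : u = c • v := by
    have h := LapSinv_LapS_of_orth (fine n M) hn0 u hu
    rw [hLap, Matrix.mulVec_smul] at h
    rw [hv]; exact h.symm
  -- ✓p682296 in the `g`-form
  have hbern : ∑ x, ‖g x‖ ^ 2 ≤ CJ * (star g ⬝ᵥ v).re := by
    have h := bernstein_up_QvOp_adjoint_pos n M hn B κ hB
    rw [← hg] at h
    exact h
  -- the Dirichlet side: `re(u^*Δ_nu) = n²·Σ|∇u|² = |c|²·re(g^* v)`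
  have hD : ((((n : ℝ) ^ 2 * ∑ ν : Fin d, ∑ x, ‖u (x + unitVec (fine n M) ν) - u x‖ ^ 2 : ℝ)) : ℂ)
      = star u ⬝ᵥ (LapS (fine n M) (n : ℂ) *ᵥ u) := by
    rw [star_dotProduct_LapS_mulVec]
    congr 1
    rw [Finset.mul_sum]
    refine Finset.sum_congr rfl fun ν _ => ?_
    rw [sum_norm_sdiff_sq]
    norm_cast
  have hD' : star u ⬝ᵥ (LapS (fine n M) (n : ℂ) *ᵥ u) = (starRingEnd ℂ c * c) * (star v ⬝ᵥ g) := by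
    rw [hLap, huv, star_smul, smul_dotProduct, dotProduct_smul, smul_eq_mul, smul_eq_mul, Complex.star_def]
    ring
  have hcc : (starRingEnd ℂ c * c) = ((‖c‖ ^ 2 : ℝ) : ℂ) := by
    rw [Complex.sq_norm, Complex.normSq_eq_conj_mul_self]
  have hre : (n : ℝ) ^ 2 * ∑ ν : Fin d, ∑ x, ‖u (x + unitVec (fine n M) ν) - u x‖ ^ 2 = ‖c‖ ^ 2 * (star g ⬝ᵥ v).re := by
    have h := congrArg Complex.re (hD.trans hD')
    rw [Complex.ofReal_re, hcc, Complex.re_ofReal_mul, re_star_dotProduct_comm v g] at h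
    exact h
  -- the Laplacian side: `Σ‖Δ_nu‖² = n⁴·Σ‖Δ_1u‖² = |c|²·Σ‖g‖²`
  have hL : ∑ x, ‖(LapS (fine n M) (n : ℂ) *ᵥ u) x‖ ^ 2 = ((n : ℝ) ^ 2) ^ 2 * ∑ x, ‖(LapS (fine n M) 1 *ᵥ u) x‖ ^ 2 := by
    rw [Finset.mul_sum]
    refine Finset.sum_congr rfl fun x _ => ?_
    rw [LapS_natCast_mulVec, norm_mul, mul_pow, norm_pow, Complex.norm_natCast]
  have hL' : ∑ x, ‖(LapS (fine n M) (n : ℂ) *ᵥ u) x‖ ^ 2 = ‖c‖ ^ 2 * ∑ x, ‖g x‖ ^ 2 := by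
    rw [hLap, Finset.mul_sum]
    refine Finset.sum_congr rfl fun x _ => ?_
    rw [Pi.smul_apply, smul_eq_mul, norm_mul, mul_pow]
  -- assemble: `n⁴Σ‖Δ_1u‖² = |c|²‖g‖² ≤ |c|²·C_J·re(g^*v) = C_J·n²Σ|∇u|²`, divide by `n²`
  have key : ((n : ℝ) ^ 2) ^ 2 * ∑ x, ‖(LapS (fine n M) 1 *ᵥ u) x‖ ^ 2
      ≤ CJ * ((n : ℝ) ^ 2 * ∑ ν : Fin d, ∑ x, ‖u (x + unitVec (fine n M) ν) - u x‖ ^ 2) := by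
    rw [← hL, hL', hre]
    have hc0 : 0 ≤ ‖c‖ ^ 2 := sq_nonneg _
    calc ‖c‖ ^ 2 * ∑ x, ‖g x‖ ^ 2 ≤ ‖c‖ ^ 2 * (CJ * (star g ⬝ᵥ v).re) := mul_le_mul_of_nonneg_left hbern hc0
      _ = CJ * (‖c‖ ^ 2 * (star g ⬝ᵥ v).re) := by ring
  have hn2 : (0 : ℝ) < (n : ℝ) ^ 2 := by positivity
  have key' : (n : ℝ) ^ 2 * ((n : ℝ) ^ 2 * ∑ x, ‖(LapS (fine n M) 1 *ᵥ u) x‖ ^ 2)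
      ≤ (n : ℝ) ^ 2 * (CJ * ∑ ν : Fin d, ∑ x, ‖u (x + unitVec (fine n M) ν) - u x‖ ^ 2) := by
    have e1 : (n : ℝ) ^ 2 * ((n : ℝ) ^ 2 * ∑ x, ‖(LapS (fine n M) 1 *ᵥ u) x‖ ^ 2)
        = ((n : ℝ) ^ 2) ^ 2 * ∑ x, ‖(LapS (fine n M) 1 *ᵥ u) x‖ ^ 2 := by ring
    have e2 : (n : ℝ) ^ 2 * (CJ * ∑ ν : Fin d, ∑ x, ‖u (x + unitVec (fine n M) ν) - u x‖ ^ 2)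
        = CJ * ((n : ℝ) ^ 2 * ∑ ν : Fin d, ∑ x, ‖u (x + unitVec (fine n M) ν) - u x‖ ^ 2) := by ring
    rw [e1, e2]; exact key
  exact le_of_mul_le_mul_left key' hn2

end Interpolant

/-! ## §2 `Site P 0` letters: one component, all components, the T³ instance -/

section SiteLetters

open LatticeFieldCalculus
open B10StarCount (sum_pbond)
open B5Eq117TorusCarriers (Mk EK)
open Summit.QuantumFields.YangMills.Theorems.Prop7CentreHarmonicDivDictionary (LapS_natCast_mulVec)
open Literature.MathematicalPhysics.QuantumFieldTheory.BalabanImbrieJaffe1984to88.BIJ85Thm711TorusTransport (EK_symm_add_unitVec)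
open Summit.QuantumFields.YangMills.Theorems.Prop7FlatRRowConst (transpose_eq_QvOp_adjoint LapS_one_mulVec_EK)

variable {P : Params} {k : ℕ}

/-- ★★ **BERNSTEIN ONE ORDER UP, ONE COMPONENT, `Site P 0` LETTERS**: `ν` a real weight on the level-`k` bonds with `Σ_y ν⟨y,κ⟩ = 0`; `f` its `Q_k`-transpose
(`∀ Y, Σ_c ν(c)·(Q_kY)(c) = Σ_b f(b)·Y(b)`, `Q_k = bondAvgIter k`); `A : PBond P 0 → ℝ` with `Δ A_κ = f_κ` (flat `laplace 1` on `x ↦ A⟨x,κ⟩`) and `Σ_x A⟨x,κ⟩ = 0`.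
THEN `(L^k)²·Σ_x ((ΔA_κ)(x))² ≤ C_J·Σ_ν Σ_x (A⟨x+e_ν,κ⟩ − A⟨x,κ⟩)²`, `C_J = dπ²·(1 + (π²∕4)^{d+1})`.
[cite: Balaban1984PropagatorsI, (1.18) p.20, (1.21) p.21, Sect. C p.22; Balaban1985Variational, Prop. 7 p.299] -/
theorem bernsteinUp_component (hk : k ≤ P.m + P.K) (ν : PBond P k → ℝ) (κ : Fin P.d) (hν : ∑ y : Site P k, ν ⟨y, κ⟩ = 0)
    (A f : PBond P 0 → ℝ)
    (hf : ∀ Y : PBond P 0 → ℝ, ∑ c : PBond P k, ν c * bondAvgIter k Y c = ∑ b : PBond P 0, f b * Y b)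
    (hLap : ∀ x : Site P 0, laplace 1 (fun z => A ⟨z, κ⟩) x = f ⟨x, κ⟩)
    (hA0 : ∑ x : Site P 0, A ⟨x, κ⟩ = 0) :
    ((P.L : ℝ) ^ k) ^ 2 * ∑ x : Site P 0, (laplace 1 (fun z => A ⟨z, κ⟩) x) ^ 2
      ≤ (P.d * Real.pi ^ 2 * (1 + (Real.pi ^ 2 / 4) ^ (P.d + 1)))
          * ∑ ν' : Fin P.d, ∑ x : Site P 0, (A ⟨x.shift ν', κ⟩ - A ⟨x, κ⟩) ^ 2 := by
  -- letters
  have hL0 : 0 < P.L := P.L_pos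
  have hn1 : 1 ≤ P.L ^ k := Nat.one_le_pow _ _ hL0
  let E := EK hk
  let u : Tor (fine (P.L ^ k) (Mk P k)) → ℂ := fun s => ((A ⟨E.symm s, κ⟩ : ℝ) : ℂ)
  let B : Tor (Mk P k) × Fin P.d → ℂ := fun c => ((ν ⟨c.1, c.2⟩ : ℝ) : ℂ)
  -- hypotheses on the carrier
  have hB : ∑ y, B (y, κ) = 0 := by
    show ∑ y : Tor (Mk P k), ((ν ⟨y, κ⟩ : ℝ) : ℂ) = 0
    rw [← Complex.ofReal_sum]
    exact_mod_cast hν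
  have hu : ∑ s, u s = 0 := by
    show ∑ s, ((A ⟨E.symm s, κ⟩ : ℝ) : ℂ) = 0
    rw [Fintype.sum_equiv E.symm (fun s => ((A ⟨E.symm s, κ⟩ : ℝ) : ℂ)) (fun x => ((A ⟨x, κ⟩ : ℝ) : ℂ)) (fun _ => rfl),
      ← Complex.ofReal_sum, hA0, Complex.ofReal_zero]
  have hLap1 : ∀ t, (LapS (fine (P.L ^ k) (Mk P k)) 1 *ᵥ u) t = ((laplace 1 (fun z => A ⟨z, κ⟩) (E.symm t) : ℝ) : ℂ) := fun t =>
    LapS_one_mulVec_EK hk (fun z => A ⟨z, κ⟩) t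
  have hLapT : LapS (fine (P.L ^ k) (Mk P k)) ((P.L ^ k : ℕ) : ℂ) *ᵥ u
      = (((P.L ^ k : ℕ) : ℂ) ^ 2) • comp (fine (P.L ^ k) (Mk P k)) ((QvOp (P.L ^ k) (Mk P k))ᴴ *ᵥ B) κ := by
    funext t
    rw [LapS_natCast_mulVec, Pi.smul_apply, smul_eq_mul]
    congr 1
    show (LapS (fine (P.L ^ k) (Mk P k)) 1 *ᵥ (fun s => ((A ⟨E.symm s, κ⟩ : ℝ) : ℂ))) t = ((QvOp (P.L ^ k) (Mk P k))ᴴ *ᵥ B) (t, κ)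
    rw [LapS_one_mulVec_EK hk (fun z => A ⟨z, κ⟩) t, hLap, transpose_eq_QvOp_adjoint hk ν f hf (E.symm t) κ]
    simp only [E, Equiv.apply_symm_apply]
    rfl
  -- §1
  have key := bernstein_interpolant_up (P.L ^ k) (Mk P k) hn1 B κ hB _ u hu hLapT
  -- read back
  have hL : ∑ s, ‖(LapS (fine (P.L ^ k) (Mk P k)) 1 *ᵥ u) s‖ ^ 2 = ∑ x : Site P 0, (laplace 1 (fun z => A ⟨z, κ⟩) x) ^ 2 := by
    have e : ∀ s, ‖(LapS (fine (P.L ^ k) (Mk P k)) 1 *ᵥ u) s‖ ^ 2 = (laplace 1 (fun z => A ⟨z, κ⟩) (E.symm s)) ^ 2 := fun s => by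
      rw [hLap1, Complex.norm_real, Real.norm_eq_abs, sq_abs]
    simp_rw [e]
    exact Fintype.sum_equiv E.symm _ _ (fun s => rfl)
  have hR : ∑ ν' : Fin P.d, ∑ s, ‖u (s + unitVec (fine (P.L ^ k) (Mk P k)) ν') - u s‖ ^ 2
      = ∑ ν' : Fin P.d, ∑ x : Site P 0, (A ⟨x.shift ν', κ⟩ - A ⟨x, κ⟩) ^ 2 := by
    refine Finset.sum_congr rfl fun ν' _ => ?_
    have e : ∀ s, ‖u (s + unitVec (fine (P.L ^ k) (Mk P k)) ν') - u s‖ ^ 2 = (A ⟨(E.symm s).shift ν', κ⟩ - A ⟨E.symm s, κ⟩) ^ 2 := by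
      intro s
      show ‖((A ⟨E.symm (s + unitVec _ ν'), κ⟩ : ℝ) : ℂ) - ((A ⟨E.symm s, κ⟩ : ℝ) : ℂ)‖ ^ 2 = _
      rw [EK_symm_add_unitVec, ← Complex.ofReal_sub, Complex.norm_real, Real.norm_eq_abs, sq_abs]
    simp_rw [e]
    exact Fintype.sum_equiv E.symm _ _ (fun s => rfl)
  have hcast : (((P.L ^ k : ℕ)) : ℝ) = (P.L : ℝ) ^ k := by push_cast; ring
  rw [hL, hR, hcast] at key
  exact key

/-- ★★★ **J-ROW★'s FLAT CORE IN `Site P 0` LETTERS** (★w4-19200 g7, 2026-08-29 00:26Z): `ν` a real level-`k` weight MEAN-FREE in every direction; `f` its `Q_k`-transpose;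
`A` a fine real bond field with `Δ A_κ = f_κ` for every component and `Σ_x A⟨x,κ⟩ = 0`.  THEN `(L^k)²·Σ_b ((ΔA)(b))² ≤ C_J·Σ_b Σ_ν (A(b + e_ν) − A(b))²` — the
flat LAPLACIAN (= the source `(Q_k)ᵀν`, = the flat model of the critical current) of the curl-minimal interpolant is `ℓ⁻²`-dominated by its Dirichlet energy,
`C_J = dπ²·(1 + (π²∕4)^{d+1})` absolute, uniform in `k` and in the volume (sum of `bernsteinUp_component` over `κ`; twin of ✓`Prop7FlatRRowConst.flatRRow_const` one order up).
[cite: Balaban1984PropagatorsI, (1.18) p.20, (1.21) p.21, Sect. C p.22; Balaban1985Variational, Prop. 7 p.299] -/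
theorem flatJRow_const (hk : k ≤ P.m + P.K) (ν : PBond P k → ℝ) (hν : ∀ κ : Fin P.d, ∑ y : Site P k, ν ⟨y, κ⟩ = 0)
    (A f : PBond P 0 → ℝ)
    (hf : ∀ Y : PBond P 0 → ℝ, ∑ c : PBond P k, ν c * bondAvgIter k Y c = ∑ b : PBond P 0, f b * Y b)
    (hLap : ∀ b : PBond P 0, laplace 1 (fun z => A ⟨z, b.dir⟩) b.src = f b)
    (hA0 : ∀ κ : Fin P.d, ∑ x : Site P 0, A ⟨x, κ⟩ = 0) :
    ((P.L : ℝ) ^ k) ^ 2 * ∑ b : PBond P 0, (laplace 1 (fun z => A ⟨z, b.dir⟩) b.src) ^ 2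
      ≤ (P.d * Real.pi ^ 2 * (1 + (Real.pi ^ 2 / 4) ^ (P.d + 1)))
          * ∑ b : PBond P 0, ∑ ν' : Fin P.d, (A ⟨b.src.shift ν', b.dir⟩ - A b) ^ 2 := by
  have hcomp : ∀ κ : Fin P.d, ((P.L : ℝ) ^ k) ^ 2 * ∑ x : Site P 0, (laplace 1 (fun z => A ⟨z, κ⟩) x) ^ 2
      ≤ (P.d * Real.pi ^ 2 * (1 + (Real.pi ^ 2 / 4) ^ (P.d + 1)))
          * ∑ ν' : Fin P.d, ∑ x : Site P 0, (A ⟨x.shift ν', κ⟩ - A ⟨x, κ⟩) ^ 2 :=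
    fun κ => bernsteinUp_component hk ν κ (hν κ) A f hf (fun x => hLap ⟨x, κ⟩) (hA0 κ)
  have h : ((P.L : ℝ) ^ k) ^ 2 * ∑ κ : Fin P.d, ∑ x : Site P 0, (laplace 1 (fun z => A ⟨z, κ⟩) x) ^ 2
      ≤ (P.d * Real.pi ^ 2 * (1 + (Real.pi ^ 2 / 4) ^ (P.d + 1)))
          * ∑ κ : Fin P.d, ∑ ν' : Fin P.d, ∑ x : Site P 0, (A ⟨x.shift ν', κ⟩ - A ⟨x, κ⟩) ^ 2 := by
    rw [Finset.mul_sum, Finset.mul_sum]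
    exact Finset.sum_le_sum fun κ _ => hcomp κ
  have eL : ∑ b : PBond P 0, (laplace 1 (fun z => A ⟨z, b.dir⟩) b.src) ^ 2
      = ∑ κ : Fin P.d, ∑ x : Site P 0, (laplace 1 (fun z => A ⟨z, κ⟩) x) ^ 2 := by
    rw [sum_pbond, Finset.sum_comm]
  have eR : ∑ b : PBond P 0, ∑ ν' : Fin P.d, (A ⟨b.src.shift ν', b.dir⟩ - A b) ^ 2
      = ∑ κ : Fin P.d, ∑ ν' : Fin P.d, ∑ x : Site P 0, (A ⟨x.shift ν', κ⟩ - A ⟨x, κ⟩) ^ 2 := by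
    rw [sum_pbond, Finset.sum_comm]
    refine Finset.sum_congr rfl fun κ _ => ?_
    rw [Finset.sum_comm]
  rw [eL, eR]
  exact h

/-- ★ **THE T³ INSTANCE** (run `K` of a T³ family, comparison height `n`, `k = K − n`, `ℓ = L^{K−n}`, `d = 3`): `ℓ²·Σ_b((ΔA)(b))² ≤ C_J·Σ_bΣ_ν(A(b+e_ν) − A(b))²` for
the curl-minimal interpolant of a per-direction mean-free level-`(K−n)` weight. [cite: Balaban1984PropagatorsI, (1.18) p.20, (1.21) p.21; Balaban1985Variational, Prop. 7 p.299] -/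
theorem flatJRow_const_T3 (F : T3ContinuumYM3Torus.T3Family) (K n : ℕ) (ν : PBond (F.P K) (K - n) → ℝ)
    (hν : ∀ κ : Fin (F.P K).d, ∑ y : Site (F.P K) (K - n), ν ⟨y, κ⟩ = 0)
    (A f : PBond (F.P K) 0 → ℝ)
    (hf : ∀ Y : PBond (F.P K) 0 → ℝ, ∑ c : PBond (F.P K) (K - n), ν c * bondAvgIter (K - n) Y c = ∑ b : PBond (F.P K) 0, f b * Y b)
    (hLap : ∀ b : PBond (F.P K) 0, laplace 1 (fun z => A ⟨z, b.dir⟩) b.src = f b)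
    (hA0 : ∀ κ : Fin (F.P K).d, ∑ x : Site (F.P K) 0, A ⟨x, κ⟩ = 0) :
    ((F.L : ℝ) ^ (K - n)) ^ 2 * ∑ b : PBond (F.P K) 0, (laplace 1 (fun z => A ⟨z, b.dir⟩) b.src) ^ 2
      ≤ ((F.P K).d * Real.pi ^ 2 * (1 + (Real.pi ^ 2 / 4) ^ ((F.P K).d + 1)))
          * ∑ b : PBond (F.P K) 0, ∑ ν' : Fin (F.P K).d, (A ⟨b.src.shift ν', b.dir⟩ - A b) ^ 2 := by
  have hk : K - n ≤ (F.P K).m + (F.P K).K := by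
    have := F.hm
    show K - n ≤ F.m + K
    omega
  exact flatJRow_const (P := F.P K) hk ν hν A f hf hLap hA0

end SiteLetters

end Summit.QuantumFields.YangMills.Theorems.Prop7FlatJRowConst

end
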